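/- Copyright: the b2b-balaban cell (near-miss cell 7), T⁴-continuum CRUX team (coordinator ruling e34b3e0c item (2)), row NE7b,
lineage t4-ne7b-formalise-leaf-02 (gen 125; E-side ∕ key-readings lineage) — the kernel JUNCTION of two landed interface modules
of the OWNER `t4-ne7b-p1`'s re-cut (α) road: gaps-ne6 g8's `…NE7b.LocalConditionalStability` (p358003) and leaf-02 g124's
`…NE7b.KeyPatternReading` (INTERFACE REQUEST NE7b IR-104-1, p357563).  Released under the licence of the surrounding project. -/
import Summits.QuantumFields.BalabanUV.T4Continuum.Spine.NE7b.LocalConditionalStability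
import Summits.QuantumFields.BalabanUV.T4Continuum.Spine.NE7b.KeyPatternReading

/-!
# THE ROAD's KEYED EXTRACTION LAWS FROM «LCS-j» ALONG THE KEY PATTERNS — the `hread` binder DISCHARGED
# (junction `LocalConditionalStability.extractionLaws_of_LCS_of_subset` ∘ `KeyPatternReading.hread_keyPattern`; row NE7b, node U5c)

Cell `pub-balaban`, sub-cell `t4`, spine estimate NE7b (`T4WeightBudget.RelWeightBound`, the cell's OWN estimate — NOT PRINTED in
[Bałaban 1983–89], NOT PROVED).  Crux-route work under `Spine/NE7b/`: ONE theorem, no definition, no `T4Continuum/Support` leaf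
typed, no `Prop` of Bałaban's minted, no `[cite:]` tag, zero `sorry`.

WHAT.  On the OWNER's re-cut (α) road (RULINGS W-ne7bp1-g103-1∕-2, SPEC IR-104-2 = W-ne7bp1-g104-4) the K-step per-class display
`PinnedExtraction.ExtractionLaws` that the END record `Support/B16HistoryTowerExtractionDataLWR` carries as `extractA` is DERIVED from
one-step inputs at the pinned steps: gaps-ne6's `extractionLaws_of_LCS_of_subset` takes, per (cutoff `K`, pinned class `x ∈ X K`),
a prefix pattern `S K x`, a READING `hread : Badx K x ⊆ badx T p₀ S K x` of the sub-class into the pattern class, the `hstep`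
identities, `PointwiseExtraction` (exponents `a`) and `LocCondStability` (exponents `b`, integrability inside) along `S K x`, and the
window's telescoping ∕ integrability displays.  Leaf-02's `KeyPatternReading` supplies, for the road's OWN carriers — key map
`kmemA n L hn hL (𝒮.reading T p₀)` of the step reading `𝒮 : StepReading P d`, sub-classes the KEY FIBRES
`fibre (kmemA …) (termSet (skelFam T p₀)) K k`, patterns the KEY PATTERNS `keyPattern T p₀ (kmemA …) K k`, pinned classes any
`X K ⊆ badGMems …` (the bad keys of record) — the reading as a THEOREM: `hread_keyPattern`.  This file composes the two BY NAME:
`extractionLaws_of_LCS_keyPattern` = `extractionLaws_of_LCS_of_subset` at `S := keyPattern T p₀ (kmemA …)`,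
`Badx K k := fibre (kmemA …) … K k`, with `hread := hread_keyPattern 𝒮 T p₀ n L hn hL hν0 hX` — NO `hread` binder is left.
What the road's `extractA` then owes per bad key of record is exactly: the `hstep` identities of the cell's tower, an inhabitant of
`PointwiseExtraction` (mechanism PROVED: `LocalConditionalStability.chebyshev_extraction`) and an inhabitant of `LocCondStability`
ALONG THE KEY PATTERN (THE residual of Bałaban's kind, refuter PRICING-NE7b F338 ∕ F353: `b` inherits print's `log g_j⁻²`
normalisation letter, [Balaban1989LargeFieldII] p. 380 l. 13–17, beaten by `a` under print's exponent conditions, (1.80) p. 384),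
plus the telescoping ∕ integrability displays — all DISPLAYED here as binders, NOT discharged.

HONEST.  [folklore] finite bookkeeping: a one-line composition of two tree theorems.  Nothing of Bałaban's is asserted, valued or
discharged; `hPE` ∕ `hLCS` ∕ `hstep` stay DISPLAYED BINDERS; NE7b NOT PRINTED ∕ NOT PROVED; spine PROVED 0∕9; rung (B)+1 on a
finite T⁴ — NOT infinite volume, NOT mass gap, NOT Clay.  HONEST DEPENDENCY: continuum YM on T⁴ ⇐ BetaPertH ∧ nine spine
estimates (0∕9 proved); BetaPertH ⇐ (D1) ∧ (D4) ∧ CAP+tail; G-an2-4 gates asym, D1 and NE2∕3∕4.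
-/

namespace Summit.QuantumFields.BalabanUV.T4Continuum.NE7b.KeyPatternLCSJunction

noncomputable section

open Finset MeasureTheory Real
open Literature.MathematicalPhysics.QuantumFieldTheory.Balaban1983to89
open Literature.MathematicalPhysics.QuantumFieldTheory.Balaban1983to89.T4LiveClassFibration
open Literature.MathematicalPhysics.QuantumFieldTheory.Balaban1983to89.T4PersistenceDictionary
open Literature.MathematicalPhysics.QuantumFieldTheory.Balaban1983to89.B13ScaleTransfer
open Summit.QuantumFields.BalabanUV.T4Continuum.B16HistoryIndexedRepr
open Summit.QuantumFields.BalabanUV.T4Continuum.B16HistoryReprChain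
open Summit.QuantumFields.BalabanUV.T4Continuum.B16HistoryReprInstance
open Summit.QuantumFields.BalabanUV.T4Continuum.B16HistoryReprReadCausal
open Summit.QuantumFields.BalabanUV.T4Continuum.HistoryAssemblyMult
open Summit.QuantumFields.BalabanUV.T4Continuum.HistoryRealiseCellsRunAssemblyWTVSData
open Summit.QuantumFields.BalabanUV.T4Continuum.NE7b.PinnedExtraction
open Summit.QuantumFields.BalabanUV.T4Continuum.NE7b.PrefixExtraction
open Summit.QuantumFields.BalabanUV.T4Continuum.NE7b.PrefixExtractionLaws
open Summit.QuantumFields.BalabanUV.T4Continuum.NE7b.LocalConditionalStability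
open Summit.QuantumFields.BalabanUV.T4Continuum.NE7b.KeyPatternReading

variable {P : Type} [DecidableEq P] {d : ℕ} (𝒮 : StepReading P d) {C : ℕ → ℕ → Type} {𝒢 : (K j : ℕ) → GoodClass (C K j)}
  (T : (K : ℕ) → Tower P (C K) (𝒢 K)) (p₀ : ℕ → ℕ → P) (n L : ℕ) (hn : 0 < n) (hL : 0 < L)
  (ρ₀ : (K : ℕ) → ℝ → C K 0 → ℝ) (hρ : ∀ K t, (𝒢 K 0).Gd (ρ₀ K t)) (h0 : ∀ K t x, 0 ≤ ρ₀ K t x)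
  (B : ℕ → ℝ → ℝ) (hB : ∀ K t, 0 < B K t) [∀ K j, MeasurableSpace (C K j)] (ν : (K j : ℕ) → Measure (C K j))

/-- **THE ROAD's KEYED EXTRACTION LAWS FROM «LCS-j» ALONG THE KEY PATTERNS, `hread` DISCHARGED**: gaps-ne6's
`LocalConditionalStability.extractionLaws_of_LCS_of_subset` at the patterns `S := keyPattern T p₀ (kmemA n L hn hL (𝒮.reading T p₀))`,
the sub-classes `Badx K k := fibre (kmemA …) (termSet (skelFam T p₀)) K k` (the key fibres) and pinned classes `X K` inside the bad
keys of record (`hX`), with the reading `hread := KeyPatternReading.hread_keyPattern 𝒮 T p₀ n L hn hL hν0 hX` — so the road's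
`ExtractionLaws` for run A's weights, with quotients `q K k = Π_{j<K} e^{b K k j − a K k j}`, follow from the `hstep` identities,
`PointwiseExtraction` and `LocCondStability` ALONG THE KEY PATTERNS and the window's telescoping ∕ integrability displays, all
displayed as binders (nothing of Bałaban's discharged). [folklore] -/
theorem extractionLaws_of_LCS_keyPattern {l₀ : ℝ} (hν0 : ∀ K j g, 𝒮.ν K j g (p₀ K j) = ∅) {jstar : ℕ → ℕ}
    (Bad : ℕ → ℝ → Finset (HIndex.Idx (skelFam T p₀)))
    (X : ℕ → Finset (Finset ((Fin d → ℕ) × Gen PEv × Multiset (PEv × ((Fin d → ℕ) × Finset (Pt d))))))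
    (hX : ∀ K, X K ⊆ badGMems (memA n L (𝒮.reading T p₀)) jstar (HIndex.termSet (skelFam T p₀))
      (kmemA n L hn hL (𝒮.reading T p₀)) K)
    (χ : (K : ℕ) → Finset ((Fin d → ℕ) × Gen PEv × Multiset (PEv × ((Fin d → ℕ) × Finset (Pt d)))) →
      (j : ℕ) → (Fin j → P) → P → C K j → ℝ)
    (M : (K : ℕ) → Finset ((Fin d → ℕ) × Gen PEv × Multiset (PEv × ((Fin d → ℕ) × Finset (Pt d)))) →
      ℝ → (j : ℕ) → (Fin j → P) → C K j → ℝ)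
    (a b : ℕ → Finset ((Fin d → ℕ) × Gen PEv × Multiset (PEv × ((Fin d → ℕ) × Finset (Pt d)))) → ℕ → ℝ)
    (hp₀ : ∀ K j g, p₀ K j ∈ (T K).branch j g)
    (bad_subset : ∀ K t, |t| ≤ l₀ → Bad K t ⊆ HIndex.termSet (skelFam T p₀) K)
    (cover : ∀ K t, |t| ≤ l₀ → ∀ τ ∈ Bad K t, ∃ k ∈ X K,
      τ ∈ fibre (kmemA n L hn hL (𝒮.reading T p₀)) (HIndex.termSet (skelFam T p₀)) K k)
    (hstep : ∀ K t, |t| ≤ l₀ → ∀ k ∈ X K, ∀ j g, j < K →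
      g ∈ admS (T K) (keyPattern T p₀ (kmemA n L hn hL (𝒮.reading T p₀)) K k) j → ∀ p ∈ (T K).branch j g,
      ∀ f : C K j → ℝ, (𝒢 K j).Gd f → ∫ y, ((T K).op j g p).T f y ∂ν K (j + 1) = ∫ y, χ K k j g p y * f y ∂ν K j)
    (hintχ : ∀ K t, |t| ≤ l₀ → ∀ k ∈ X K, ∀ j g, j < K →
      g ∈ admS (T K) (keyPattern T p₀ (kmemA n L hn hL (𝒮.reading T p₀)) K k) j → ∀ p ∈ (T K).branch j g,
      Integrable (fun y => χ K k j g p y * (T K).eterm (ρ₀ K t) j g y) (ν K j))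
    (hPE : ∀ K t, |t| ≤ l₀ → ∀ k ∈ X K,
      PointwiseExtraction (T K) (keyPattern T p₀ (kmemA n L hn hL (𝒮.reading T p₀)) K k) K (χ K k) (M K k t)
        (fun j _ => a K k j))
    (hLCS : ∀ K t, |t| ≤ l₀ → ∀ k ∈ X K,
      LocCondStability (T K) (keyPattern T p₀ (kmemA n L hn hL (𝒮.reading T p₀)) K k) K (ν K) (ρ₀ K t) (M K k t)
        (fun j _ => b K k j))
    (hint : ∀ K t, |t| ≤ l₀ → ∀ j g, j < K → g ∈ (T K).adm j → Integrable ((T K).eterm (ρ₀ K t) j g) (ν K j))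
    (hint' : ∀ K t, |t| ≤ l₀ → ∀ j g p, j < K → g ∈ (T K).adm j → p ∈ (T K).branch j g →
      Integrable (((T K).op j g p).T ((T K).eterm (ρ₀ K t) j g)) (ν K (j + 1)))
    (hpres : ∀ K t, |t| ≤ l₀ → ∀ j g, j < K → g ∈ (T K).adm j →
      ∫ x, (∑ p ∈ (T K).branch j g, ((T K).op j g p).T ((T K).eterm (ρ₀ K t) j g) x) ∂ν K (j + 1) =
        ∫ x, (T K).eterm (ρ₀ K t) j g x ∂ν K j)
    (hintM : ∀ K t, |t| ≤ l₀ → ∀ a', ∀ ι ∈ (skelFam T p₀ K).LIdx a',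
      Integrable ((reprFam T p₀ ρ₀ hρ h0 B hB K t).eterm a' ι) (ν K K)) :
    ExtractionLaws l₀ (HIndex.termSet (skelFam T p₀))
      (fun _ t => Repr172R.weight (I := skelFam T p₀) (fun K => ν K K) (reprFam T p₀ ρ₀ hρ h0 B hB) t)
      Bad X (fun K k => fibre (kmemA n L hn hL (𝒮.reading T p₀)) (HIndex.termSet (skelFam T p₀)) K k)
      (fun K k => ∏ j ∈ Finset.range K, exp (b K k j - a K k j)) :=
  extractionLaws_of_LCS_of_subset T p₀ ρ₀ hρ h0 B hB ν (keyPattern T p₀ (kmemA n L hn hL (𝒮.reading T p₀))) χ M a b Bad X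
    (fun K k => fibre (kmemA n L hn hL (𝒮.reading T p₀)) (HIndex.termSet (skelFam T p₀)) K k) hp₀ bad_subset cover
    (hread_keyPattern 𝒮 T p₀ n L hn hL hν0 hX) hstep hintχ hPE hLCS hint hint' hpres hintM

end

end Summit.QuantumFields.BalabanUV.T4Continuum.NE7b.KeyPatternLCSJunction
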